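import Summits.QuantumFields.YangMills.Theorems.GronwallGapContinuumFromLatticeGapDecayOfUniformTools
import Summits.QuantumFields.YangMills.Theorems.GronwallGapContinuumFromLatticeGapStubPairingDictionary
import HarnessLib

/-!
# `ContinuumFromLatticeGap` (stmt-QuantumFields-15915), line `registered`, reshape 6: the decay leg from UNIFORM
# monomial constants — `decay_of_uniformMonomials`

Support file for the crux item stmt-QuantumFields-15915 (`GronwallGap.ContinuumFromLatticeGap`), reshape 6 of line
`registered`.  It replaces the decay leg `stub_decayOfRPSpectralLocal` (which consumed W₁'s RP-spectral conjunct (b):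
RELATIVE clustering of every bounded local slab functional with a `Y`-UNIFORM thermal constant) by a decay leg that needs
NO such input: `Decay (planeSum T) (Δ/2)` follows from

* torus reflection positivity in the `latticeConnectedCorr` currency (landed RP core of stmt-15828): for the SHIFTED
  functional `F_k := Y_k ∘ configShift e₀` of the decay leg's own real functional `Y_k`, `j ↦ g_k(j) := corr(F_k∘Θ, F_k; j)` is
  non-negative and log-convex on `0 ≤ j ≤ L_k` (`RpCoreA.corr_nonneg`, `RpCoreA.corr_logConvex`);
* the pairing dictionary (`stub_pairingDictionary`): the decay leg's reflected pairings minus the squared mean ARE `g_k(j)`;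
* the far bound: `F_k` is a finite real combination of plaquette MONOMIALS (`shifted_eq_sum`), so Minkowski for the PSD form
  (`stub_rpSeminorm`) and the UNIFORM monomial constants `Cmono n d` along the scheme give
  `g_k(L_k) ≤ D_k e^{−Δ a_k L_k}` with `D_k = max 1 ((Σ|coeff|)² · Cmono(n, d'_k))`, `d'_k = ⌊⌈ρ⌉/a_k⌋ + 2`;
* the two-case chord (`stub_chordTwoCase`): `g_k(j) ≤ e^{−(Δ/2) a_k j} g_k(0) + D_k e^{−(Δ/2) a_k L_k}` — these three
  steps are the abstract core `corr_chord_of_expansion` of the tools file;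
* the volumes absorb the constants (hypothesis `(log Cmono(n, ⌊ρ'/a_k⌋+2) + |log a_k|)/(a_k L_k) → 0`): the error term
  tends to `0`, and the landed limit machinery of the decay leg (`tendsto_rpPair`, `tendsto_mean`,
  `planeSum_osAdjoint_eq_conj`, `planeSum_translate_eq`) gives `Re conn(F, T_tF) ≤ e^{−(Δ/2)t} Re conn(F, F)` on the separated
  class (`decay_separated_uniform`), then `Decay` by density (`decay_of_uniformMonomials`).

No definitions, no named facts.  Refs: OsterwalderSeiler1978 §§2–3; GlimmJaffe1987 §6.1, §19.7; OsterwalderSchrader1973 §4.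
-/

noncomputable section

open scoped SchwartzMap BigOperators ComplexConjugate
open MeasureTheory Filter Topology
open Literature.MathematicalPhysics.QuantumFieldTheory Literature.MathematicalPhysics.QuantumLattice
open Literature.MathematicalPhysics.AQFT
open Literature.Probability.LatticeModels (box Site mem_box)
open Summit.QuantumFields.YangMills.Cruxes.HypercubicLimit.CouplingResponse
open Summit.QuantumFields.YangMills.Cruxes.OSLegsFromFemtoAndGap.DlrCollarTransfer (plane conn Decay)
open Summit.QuantumFields.YangMills.Cruxes.OSLegsAtWeakCouplingC.Sketch (Separated)
open Summit.QuantumFields.YangMills.Theorems.OSLegsFromFemtoAndGap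
open Summit.QuantumFields.YangMills.Theorems.WeakCouplingHypercubicLimit.TraceNormColdPressure
open Summit.QuantumFields.YangMills.Theorems.ContinuumLegGivenGap

namespace Summit.QuantumFields.YangMills.Theorems.ContinuumFromLatticeGap

variable {G : Type} [Group G] [TopologicalSpace G] [IsTopologicalGroup G] [CompactSpace G]
  [MeasurableSpace G] [BorelSpace G]

/-! ### The lattice decay inequality and its limit -/

section Main2

variable (r : LatticeRep G) (sch : SpeciesScheme (YMSpecies G)) (φ : ℕ → ℕ) (hφ : StrictMono φ)
  (T : (n : ℕ) → (Fin n → Plane) → (𝓢((Fin n → EuclideanSpace ℝ (Fin 4)), ℂ) →L[ℂ] ℂ))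
  (hUFB : UniformFunctionalBoundPlanes r sch) (hPL : PlaneLimits r sch φ T)
  {n : ℕ} {F : 𝓢((Fin n → EuclideanSpace ℝ (Fin 4)), ℂ)} {ρ τ δ : ℝ} (hτ : 0 < τ) (hδ : 0 < δ) (hρ : 0 ≤ ρ)
  (hFρ : tsupport (F : (Fin n → EuclideanSpace ℝ (Fin 4)) → ℂ) ⊆ Metric.closedBall 0 ρ)
  (hFτ : tsupport (F : (Fin n → EuclideanSpace ℝ (Fin 4)) → ℂ) ⊆ {u | ∀ l, τ ≤ u l 0})
  (hFδ : tsupport (F : (Fin n → EuclideanSpace ℝ (Fin 4)) → ℂ) ⊆ Separated n δ)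
  (hFr : ∀ u, conj (F u) = F u)

include hφ hUFB hPL hτ hδ hρ hFρ hFτ hFδ hFr

set_option maxHeartbeats 1600000 in
/-- **The decay inequality on the separated class, from UNIFORM monomial constants.**  Along a scheme at non-negative
coupling (eventually) with polynomial renormalisation and a bounded counterterm, given ONE clustering constant `Cmono n d ≥ 1`
per (arity, box) for the reflected diagonal pairs of plaquette monomials on the scheme's own tori at rate `Δ a_k`, and volumes
absorbing these constants, for a real test function supported at `δ`-separated points with times in `[τ, ρ]` and every
`t ≥ 0`: `Re conn(F, T_t F) ≤ Re conn(F, F) · e^{−(Δ/2)t}` for the candidate family `planeSum T` (torus RP chord + Minkowski +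
dictionary; no RP-spectral input).
-- adapted from Theorems/GronwallGapContinuumFromLatticeGapDecayOfRPSpectralLocal.lean [folklore] -/
theorem decay_separated_uniform (hpr : PolyRenorm r sch) (hbm : ∃ Cm : ℝ, ∀ k, |sch.m r.curvature k| ≤ Cm)
    (hβ0 : ∀ᶠ k in atTop, 0 ≤ sch.β k) {Δ : ℝ} (hΔ : 0 < Δ) (Cmono : ℕ → ℕ → ℝ) (hC1 : ∀ n d, 1 ≤ Cmono n d)
    (hmono : ∀ (n d : ℕ) (q : Fin n → Fin 4 × Fin 4) (y : Fin n → Site 4),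
      (∀ l, (0 ≤ y l 0 ∧ y l 0 ≤ (d : ℤ)) ∧ ∀ i : Fin 4, i ≠ 0 → |y l i| ≤ (d : ℤ)) →
      ∀ (s : Finset (Fin n)) (k j : ℕ), j ≤ sch.L k →
        latticeConnectedCorr r.ρ (sch.β k) (2 * sch.L k + 1)
            ((fun V => ∏ l ∈ s, plane G r (q l) (y l) V) ∘ gaugeTimeReflect)
            (fun V => ∏ l ∈ s, plane G r (q l) (y l) V) j ≤ Cmono n d * Real.exp (-(Δ * sch.a k * j)))
    (habs : ∀ n ρ : ℕ, Tendsto (fun k => (Real.log (Cmono n (⌊(ρ : ℝ) / sch.a k⌋₊ + 2)) + |Real.log (sch.a k)|) /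
      (sch.a k * (sch.L k : ℝ))) atTop (𝓝 0))
    {t : ℝ} (ht : 0 ≤ t) :
    (conn (planeSum T) F (translateMulti (EuclideanSpace.single (0 : Fin 4) t) F)).re ≤
      (conn (planeSum T) F F).re * Real.exp (-(Δ / 2 * t)) := by
  classical
  obtain ⟨Cp, hCp0, hfacts⟩ := curvFunctional_facts G r
  obtain ⟨Cm, hCm⟩ := hbm
  obtain ⟨Qr, hQr⟩ := hpr
  have hCm0 : 0 ≤ Cm := (abs_nonneg _).trans (hCm 0)
  have hFps := posSep_of_separated hδ hτ hFδ hFτ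
  have hFo : IsOffDiagonal F := isOffDiagonal_of_posSep hFps
  -- lattice times and translation vectors
  have ha0 : Tendsto (fun k => sch.a (φ k)) atTop (𝓝 0) := sch.tendsto_a.comp hφ.tendsto_atTop
  have haL : Tendsto (fun k => sch.a (φ k) * sch.L (φ k)) atTop atTop := sch.tendsto_L.comp hφ.tendsto_atTop
  obtain ⟨hjb, hcoef⟩ := latticeTime_facts ht (fun k => sch.a_pos (φ k)) ha0
  set jj : ℕ → ℕ := fun k => ⌊t / (2 * sch.a (φ k))⌋₊ with hjj
  set vv : ℕ → EuclideanSpace ℝ (Fin 4) := fun k =>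
    ((((2 * jj k : ℕ) : ℝ) * sch.a (φ k)) • EuclideanSpace.single (0 : Fin 4) (1 : ℝ)) with hvv
  have hvv_lim : Tendsto vv atTop (𝓝 (EuclideanSpace.single (0 : Fin 4) t)) := by
    have h := hcoef.smul_const (EuclideanSpace.single (0 : Fin 4) (1 : ℝ))
    rwa [smul_single_one_eq] at h
  have hvv0 : ∀ k, 0 ≤ vv k 0 := fun k => by
    have h1 : vv k 0 = ((2 * jj k : ℕ) : ℝ) * sch.a (φ k) := by simp [hvv]
    rw [h1]; exact mul_nonneg (Nat.cast_nonneg _) (sch.a_pos (φ k)).le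
  -- the renormalised test functions are real
  have hFkr : ∀ k x, conj (((((sch.c r.curvature (φ k) * sch.a (φ k) ^ 4) ^ n : ℝ) : ℂ) • F) x) =
      ((((sch.c r.curvature (φ k) * sch.a (φ k) ^ 4) ^ n : ℝ) : ℂ) • F) x := fun k x => by
    show conj ((_ : ℂ) • F x) = (_ : ℂ) • F x
    rw [smul_eq_mul, map_mul, Complex.conj_ofReal, hFr x]
  -- the three continuum quantities as limits of lattice pairings (toolkit A)
  have hP2 := tendsto_rpPair r sch φ hφ T hUFB hPL hτ hδ hFρ hFτ hFδ F hFps vv _ hvv_lim hvv0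
  have hP0 := tendsto_rpPair r sch φ hφ T hUFB hPL hτ hδ hFρ hFτ hFδ F hFps (fun _ => 0) 0 tendsto_const_nhds
    (fun _ => le_rfl)
  simp only [translateMulti_zero_eq] at hP0
  have hP1 := tendsto_mean r sch φ T hPL hτ hδ hFτ hFδ
  -- identities of the limit family on this class
  have hherm := planeSum_osAdjoint_eq_conj r sch φ hφ T hUFB hPL hτ hδ hFρ hFτ hFδ
  have hreal := conj_planeSum_eq r sch φ T hPL hτ hδ hFτ hFδ hFr
  have htrans := planeSum_translate_eq r sch φ hφ T hUFB hPL hτ hδ hρ hFρ hFτ hFδ ht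
  -- the real lattice functional `Y k` and its facts (toolkit SG-A)
  obtain ⟨Y, hY⟩ : ∃ Y : ℕ → LGConfig 4 G → ℝ, Y = fun k V =>
      (∑ q ∈ Fintype.piFinset (fun _ : Fin n => Finset.univ.filter fun p : Fin 4 × Fin 4 => p.1 < p.2),
        ∑ y ∈ Fintype.piFinset (fun _ : Fin n => box 4 (sch.L (φ k))),
          ((((sch.c r.curvature (φ k) * sch.a (φ k) ^ 4) ^ n : ℝ) : ℂ) • F) (fun l => sch.a (φ k) • siteToE (y l)) *
            ((∏ l, (plane G r (q l) (y l) V - sch.m r.curvature (φ k) / 6) : ℝ) : ℂ)).re := ⟨_, rfl⟩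
  have hm6 : ∀ k, ∀ q : Fin 4 × Fin 4, |(fun _ : Fin 4 × Fin 4 => sch.m r.curvature (φ k) / 6) q| ≤ Cm / 6 := by
    intro k q
    show |sch.m r.curvature (φ k) / 6| ≤ Cm / 6
    rw [abs_div, abs_of_pos (by norm_num : (0:ℝ) < 6)]
    exact div_le_div_of_nonneg_right (hCm _) (by norm_num)
  have hYm : ∀ k, Measurable (Y k) := fun k => by
    rw [hY]; exact (hfacts (sch.L (φ k)) (sch.a (φ k)) n _ _ _ (hm6 k)).1
  have hYb : ∀ k V, |Y k V| ≤ (6 * (Cp + Cm / 6)) ^ n *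
      ∑ y ∈ Fintype.piFinset (fun _ : Fin n => box 4 (sch.L (φ k))),
        ‖((((sch.c r.curvature (φ k) * sch.a (φ k) ^ 4) ^ n : ℝ) : ℂ) • F) (fun l => sch.a (φ k) • siteToE (y l))‖ :=
    fun k V => by rw [hY]; exact (hfacts (sch.L (φ k)) (sch.a (φ k)) n _ _ _ (hm6 k)).2.1 V
  have hYR : ∀ k, DependsOn (Y k) {e : Literature.MathematicalPhysics.QuantumLattice.ZdEdge 4 |
      (1 ≤ e.1 0 ∧ e.1 0 + (if e.2 = 0 then 1 else 0) ≤ ((⌊ρ / sch.a (φ k)⌋₊ + 2 : ℕ) : ℤ)) ∧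
        ∀ i : Fin 4, i ≠ 0 → |e.1 i| ≤ ((⌊ρ / sch.a (φ k)⌋₊ + 2 : ℕ) : ℤ)} := fun k => by
    rw [hY]
    exact curvFunctional_dependsOn_slabBox r (sch.L (φ k)) (sch.a (φ k)) n
      ((((sch.c r.curvature (φ k) * sch.a (φ k) ^ 4) ^ n : ℝ) : ℂ) • F) (fun _ => sch.m r.curvature (φ k) / 6)
      (⌊ρ / sch.a (φ k)⌋₊ + 2) (⌊ρ / sch.a (φ k)⌋₊ + 2)
      (slab_support r sch φ hτ hFρ hFτ k) (slabBox_support r sch φ hFρ k)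
  -- the smeared field is the real functional read through the lift
  have hYf : ∀ k (U : GaugeConfig 4 (2 * sch.L (φ k) + 1) G),
      fieldObs r (sch.L (φ k)) (sch.a (φ k)) ((((sch.c r.curvature (φ k) * sch.a (φ k) ^ 4) ^ n : ℝ) : ℂ) • F)
        (fun _ => sch.m r.curvature (φ k) / 6) U = ((Y k (torusLift (2 * sch.L (φ k) + 1) U) : ℝ) : ℂ) := by
    intro k U
    have hre := Complex.conj_eq_iff_re.1 (conj_fieldObs r (sch.L (φ k)) (sch.a (φ k)) _
      (fun _ => sch.m r.curvature (φ k) / 6) (hFkr k) U)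
    rw [← hre, hY]
    rfl
  /- ### Reshape 6: the bookkeeping of the monomial expansion -/
  -- the larger natural radius and the two slab heights
  set ρ' : ℕ := ⌈ρ⌉₊ with hρ'
  have hρρ' : ρ ≤ (ρ' : ℝ) := Nat.le_ceil ρ
  have hdd' : ∀ k, ⌊ρ / sch.a (φ k)⌋₊ + 2 ≤ ⌊(ρ' : ℝ) / sch.a (φ k)⌋₊ + 2 := fun k =>
    Nat.add_le_add_right (Nat.floor_le_floor (div_le_div_of_nonneg_right hρρ' (sch.a_pos (φ k)).le)) 2
  -- the index sets, coefficients and monomials of the expansion of `Y k ∘ configShift e₀`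
  obtain ⟨idx, hidx⟩ : ∃ idx : ℕ → Finset ((Fin n → Fin 4 × Fin 4) × (Fin n → Site 4) × Finset (Fin n)),
      idx = fun k => (Fintype.piFinset fun _ : Fin n => Finset.univ.filter fun p : Fin 4 × Fin 4 => p.1 < p.2) ×ˢ
        ((Fintype.piFinset fun _ : Fin n =>
            (Fintype.piFinset fun _ : Fin 4 => Finset.Icc (-((⌊ρ / sch.a (φ k)⌋₊ + 2 : ℕ) : ℤ)) (⌊ρ / sch.a (φ k)⌋₊ + 2 : ℕ)).filter
              fun y : Site 4 => 1 ≤ y 0 ∧ y 0 + 1 ≤ ((⌊ρ / sch.a (φ k)⌋₊ + 2 : ℕ) : ℤ)) ×ˢ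
          (Finset.univ : Finset (Fin n)).powerset) := ⟨_, rfl⟩
  obtain ⟨cc, hcc⟩ : ∃ cc : ℕ → ((Fin n → Fin 4 × Fin 4) × (Fin n → Site 4) × Finset (Fin n)) → ℝ,
      cc = fun k i => (((((sch.c r.curvature (φ k) * sch.a (φ k) ^ 4) ^ n : ℝ) : ℂ) • F)
        (fun l => sch.a (φ k) • siteToE (i.2.1 l))).re *
          ∏ _l ∈ Finset.univ \ i.2.2, (-(sch.m r.curvature (φ k) / 6)) := ⟨_, rfl⟩
  obtain ⟨M, hM⟩ : ∃ M : ℕ → ((Fin n → Fin 4 × Fin 4) × (Fin n → Site 4) × Finset (Fin n)) → LGConfig 4 G → ℝ,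
      M = fun k i V => ∏ l ∈ i.2.2, plane G r (i.1 l) (i.2.1 l - Pi.single 0 1) V := ⟨_, rfl⟩
  -- sites with a non-zero coefficient are good
  have hgood : ∀ k (y : Fin n → Site 4),
      ((((sch.c r.curvature (φ k) * sch.a (φ k) ^ 4) ^ n : ℝ) : ℂ) • F) (fun l => sch.a (φ k) • siteToE (y l)) ≠ 0 →
        ∀ l, (1 ≤ y l 0 ∧ y l 0 + 1 ≤ ((⌊ρ / sch.a (φ k)⌋₊ + 2 : ℕ) : ℤ)) ∧
          ∀ i : Fin 4, |y l i| + 1 ≤ ((⌊ρ / sch.a (φ k)⌋₊ + 2 : ℕ) : ℤ) := by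
    intro k y hy l
    have hs := slab_support r sch φ hτ hFρ hFτ k y hy l
    refine ⟨hs, fun i => ?_⟩
    by_cases hi : i = 0
    · subst hi; rw [abs_of_pos (by omega)]; exact hs.2
    · exact slabBox_support r sch φ hFρ k y hy l i hi
  -- the expansion
  have hexp : ∀ k, ⌊ρ / sch.a (φ k)⌋₊ + 2 ≤ sch.L (φ k) →
      Y k ∘ configShift (Pi.single 0 1) = fun V => ∑ i ∈ idx k, cc k i * M k i V := by
    intro k hdkL
    funext V
    simp only [Function.comp_apply, hY, hidx, hcc, hM]
    exact shifted_eq_sum r (sch.L (φ k)) (sch.a (φ k)) _ _ _ hdkL (hgood k) V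
  -- facts about the monomials (for indices in `idx k`)
  have hMfacts : ∀ k, ∀ i ∈ idx k,
      Measurable (M k i) ∧ (∃ C : ℝ, ∀ V, |M k i V| ≤ C) ∧
      IsCylinder (M k i) (i.2.2.biUnion fun l => (originPlaquetteSupport (i.1 l).1 (i.1 l).2).image
        fun e' : Literature.MathematicalPhysics.QuantumLattice.ZdEdge 4 => (e'.1 - -(i.2.1 l - Pi.single 0 1), e'.2)) ∧
      (∀ e : Literature.MathematicalPhysics.QuantumLattice.ZdEdge 4,
        e ∈ (i.2.2.biUnion fun l => (originPlaquetteSupport (i.1 l).1 (i.1 l).2).image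
          fun e' : Literature.MathematicalPhysics.QuantumLattice.ZdEdge 4 => (e'.1 - -(i.2.1 l - Pi.single 0 1), e'.2)) →
        0 ≤ e.1 0 ∧ e.1 0 ≤ ((⌊ρ / sch.a (φ k)⌋₊ + 2 : ℕ) : ℤ)) ∧
      (∀ l, (0 ≤ (i.2.1 l - (Pi.single 0 1 : Site 4)) 0 ∧
          (i.2.1 l - (Pi.single 0 1 : Site 4)) 0 ≤ ((⌊(ρ' : ℝ) / sch.a (φ k)⌋₊ + 2 : ℕ) : ℤ)) ∧
        ∀ j : Fin 4, j ≠ 0 → |(i.2.1 l - (Pi.single 0 1 : Site 4)) j| ≤ ((⌊(ρ' : ℝ) / sch.a (φ k)⌋₊ + 2 : ℕ) : ℤ)) := by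
    intro k i hi
    rw [hidx, Finset.mem_product, Finset.mem_product] at hi
    obtain ⟨hz, hbox'⟩ := good_shift_box (hdd' k) hi.2.1
    obtain ⟨h1, h2, h3, h4⟩ := monomial_facts r i.1 (fun l => i.2.1 l - Pi.single 0 1) i.2.2 _ hz
    rw [hM]
    exact ⟨h1, h2, h3, h4, hbox'⟩
  -- the `ℓ¹` mass of the coefficients: `Σ |cc k i| ≤ K₂ (a⁻¹)^{Qr n}` (`coeff_mass_le`)
  set K₂ : ℝ := 6 ^ n * 2 ^ n * max 1 (Cm / 6) ^ n * ((2 * ρ + 3) ^ (4 * n) * SchwartzMap.seminorm ℂ 0 0 F) with hK₂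
  have hccsum : ∀ k, sch.a (φ k) ≤ 1 → ∑ i ∈ idx k, |cc k i| ≤ K₂ * (sch.a (φ k))⁻¹ ^ (Qr * n) := by
    intro k hak
    rw [hidx, hcc]
    exact coeff_mass_le r sch F hρ hFρ hQr hCm (φ k) hak _
  /- ### Eventual geometric conditions -/
  have ha1 : ∀ᶠ k in atTop, sch.a (φ k) ≤ 1 := ha0.eventually (ge_mem_nhds one_pos)
  have hβ0φ : ∀ᶠ k in atTop, 0 ≤ sch.β (φ k) := hφ.tendsto_atTop.eventually hβ0
  have hgeom : ∀ᶠ k in atTop, 2 * (⌊ρ / sch.a (φ k)⌋₊ + 2) + 8 ≤ sch.L (φ k) ∧ 2 * jj k ≤ sch.L (φ k) ∧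
      0 < sch.L (φ k) := eventually_geometry (fun k => sch.a_pos (φ k)) ha1 haL hρ (fun k => (hjb k).2)
  have hbox := box_margin r sch φ hφ hρ hFρ ht
  /- ### The error term and its limit -/
  have hε : Tendsto (fun k => (Real.log (Cmono n (⌊(ρ' : ℝ) / sch.a (φ k)⌋₊ + 2)) + |Real.log (sch.a (φ k))|) /
      (sch.a (φ k) * (sch.L (φ k) : ℝ))) atTop (𝓝 0) := (habs n ρ').comp hφ.tendsto_atTop
  have hTh : Tendsto (fun k => max 1 ((K₂ * (sch.a (φ k))⁻¹ ^ (Qr * n)) ^ 2 * Cmono n (⌊(ρ' : ℝ) / sch.a (φ k)⌋₊ + 2)) *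
      Real.exp (-(Δ / 2 * (sch.a (φ k) * (sch.L (φ k) : ℝ))))) atTop (𝓝 0) :=
    err_tendsto_zero (fun k => sch.a_pos (φ k)) ha1 (fun k => hC1 _ _) haL hε K₂ (Qr * n) hΔ
  /- ### The lattice inequality, eventually, in terms of the complex pairings -/
  have hineq : ∀ᶠ k in atTop,
      (∫ U, conj (fieldObs r (sch.L (φ k)) (sch.a (φ k))
            ((((sch.c r.curvature (φ k) * sch.a (φ k) ^ 4) ^ n : ℝ) : ℂ) • F) (fun _ => sch.m r.curvature (φ k) / 6)
            (GaugeConfig.timeReflect U)) *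
          fieldObs r (sch.L (φ k)) (sch.a (φ k))
            ((((sch.c r.curvature (φ k) * sch.a (φ k) ^ 4) ^ n : ℝ) : ℂ) • translateMulti (vv k) F)
            (fun _ => sch.m r.curvature (φ k) / 6) U
        ∂(wilsonMeasure r.ρ (sch.β (φ k)) : Measure (GaugeConfig 4 (2 * sch.L (φ k) + 1) G))).re -
        (∫ U, fieldObs r (sch.L (φ k)) (sch.a (φ k))
          ((((sch.c r.curvature (φ k) * sch.a (φ k) ^ 4) ^ n : ℝ) : ℂ) • F) (fun _ => sch.m r.curvature (φ k) / 6) U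
          ∂(wilsonMeasure r.ρ (sch.β (φ k)) : Measure (GaugeConfig 4 (2 * sch.L (φ k) + 1) G))).re ^ 2 ≤
      Real.exp (-(Δ * sch.a (φ k) / 2 * ((2 * jj k : ℕ) : ℝ))) *
        ((∫ U, conj (fieldObs r (sch.L (φ k)) (sch.a (φ k))
            ((((sch.c r.curvature (φ k) * sch.a (φ k) ^ 4) ^ n : ℝ) : ℂ) • F) (fun _ => sch.m r.curvature (φ k) / 6)
            (GaugeConfig.timeReflect U)) *
          fieldObs r (sch.L (φ k)) (sch.a (φ k))
            ((((sch.c r.curvature (φ k) * sch.a (φ k) ^ 4) ^ n : ℝ) : ℂ) • F)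
            (fun _ => sch.m r.curvature (φ k) / 6) U
          ∂(wilsonMeasure r.ρ (sch.β (φ k)) : Measure (GaugeConfig 4 (2 * sch.L (φ k) + 1) G))).re -
        (∫ U, fieldObs r (sch.L (φ k)) (sch.a (φ k))
          ((((sch.c r.curvature (φ k) * sch.a (φ k) ^ 4) ^ n : ℝ) : ℂ) • F) (fun _ => sch.m r.curvature (φ k) / 6) U
          ∂(wilsonMeasure r.ρ (sch.β (φ k)) : Measure (GaugeConfig 4 (2 * sch.L (φ k) + 1) G))).re ^ 2) +
      max 1 ((K₂ * (sch.a (φ k))⁻¹ ^ (Qr * n)) ^ 2 * Cmono n (⌊(ρ' : ℝ) / sch.a (φ k)⌋₊ + 2)) *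
        Real.exp (-(Δ / 2 * (sch.a (φ k) * (sch.L (φ k) : ℝ)))) := by
    filter_upwards [hgeom, hbox, ha1, hβ0φ] with k hgk hbk hak hβk
    obtain ⟨hRP, hjjL, hLpos⟩ := hgk
    have hdkL : ⌊ρ / sch.a (φ k)⌋₊ + 2 ≤ sch.L (φ k) := by omega
    -- the shifted functional and its facts
    have hF'm : Measurable (Y k ∘ configShift (Pi.single 0 1)) := (hYm k).comp (configShift _).measurable
    have hF'b : ∃ C : ℝ, ∀ U, |(Y k ∘ configShift (Pi.single 0 1)) U| ≤ C := ⟨_, fun U => hYb k _⟩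
    obtain ⟨hF'c, htF'⟩ := shifted_isCylinder (hYR k)
    -- each monomial's far value by its UNIFORM constant
    have hfar : ∀ i ∈ idx k, latticeConnectedCorr r.ρ (sch.β (φ k)) (2 * sch.L (φ k) + 1)
        (M k i ∘ gaugeTimeReflect) (M k i) (sch.L (φ k)) ≤
        Cmono n (⌊(ρ' : ℝ) / sch.a (φ k)⌋₊ + 2) * Real.exp (-(Δ * sch.a (φ k) * (sch.L (φ k) : ℕ))) := by
      intro i hi
      have h := hmono n (⌊(ρ' : ℝ) / sch.a (φ k)⌋₊ + 2) i.1 (fun l => i.2.1 l - Pi.single 0 1) (hMfacts k i hi).2.2.2.2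
        i.2.2 (φ k) (sch.L (φ k)) le_rfl
      rw [hM]
      exact h
    -- the abstract core: positivity, log-convexity, Minkowski, far values, the two-case chord
    have ha := sch.a_pos (φ k)
    have hchord := corr_chord_of_expansion r hβk (sch.L (φ k)) (⌊ρ / sch.a (φ k)⌋₊ + 2) hRP hLpos hF'm hF'b hF'c htF'
      (idx k) (cc k) (M k)
      (fun i => i.2.2.biUnion fun l => (originPlaquetteSupport (i.1 l).1 (i.1 l).2).image
        fun e' : Literature.MathematicalPhysics.QuantumLattice.ZdEdge 4 => (e'.1 - -(i.2.1 l - Pi.single 0 1), e'.2))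
      (fun i hi => (hMfacts k i hi).1) (fun i hi => (hMfacts k i hi).2.1) (fun i hi => (hMfacts k i hi).2.2.1)
      (fun i hi => (hMfacts k i hi).2.2.2.1) (hexp k hdkL) (μ := Δ * sch.a (φ k))
      (C := Cmono n (⌊(ρ' : ℝ) / sch.a (φ k)⌋₊ + 2)) (X := K₂ * (sch.a (φ k))⁻¹ ^ (Qr * n))
      (by positivity) (zero_le_one.trans (hC1 _ _)) (hccsum k hak) hfar (2 * jj k) hjjL
    -- the dictionary: the decay-leg pairings are the values of `g`
    have hdict := stub_pairingDictionary G r (sch.β (φ k)) (sch.L (φ k)) (Y k) (hYm k) ⟨_, hYb k⟩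
    have hd2 := hdict (2 * jj k)
    have hd0 := hdict 0
    have hshift0 : ∀ U : GaugeConfig 4 (2 * sch.L (φ k) + 1) G,
        Y k (configShift (-Pi.single 0 ((0 : ℕ) : ℤ)) (torusLift (2 * sch.L (φ k) + 1) U)) =
          Y k (torusLift (2 * sch.L (φ k) + 1) U) := fun U => by
      congr 1; ext e; simp [configShift_apply]
    simp_rw [hshift0] at hd0
    -- the three real integrals are the real parts of the complex pairings
    have e1 : ∀ U : GaugeConfig 4 (2 * sch.L (φ k) + 1) G, ((Y k (torusLift (2 * sch.L (φ k) + 1) U) : ℝ) : ℂ) =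
        fieldObs r (sch.L (φ k)) (sch.a (φ k)) ((((sch.c r.curvature (φ k) * sch.a (φ k) ^ 4) ^ n : ℝ) : ℂ) • F)
          (fun _ => sch.m r.curvature (φ k) / 6) U := fun U => (hYf k U).symm
    have e2 : ∀ U : GaugeConfig 4 (2 * sch.L (φ k) + 1) G,
        ((Y k (configShift (-Pi.single 0 ((2 * jj k : ℕ) : ℤ)) (torusLift (2 * sch.L (φ k) + 1) U)) : ℝ) : ℂ) =
        fieldObs r (sch.L (φ k)) (sch.a (φ k))
          ((((sch.c r.curvature (φ k) * sch.a (φ k) ^ 4) ^ n : ℝ) : ℂ) • translateMulti (vv k) F)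
          (fun _ => sch.m r.curvature (φ k) / 6) U := by
      intro U
      rw [← torusLift_torusConfigShift_proj, e1, ← map_smul]
      exact (fieldObs_translateMulti_eq r (sch.L (φ k)) (sch.a (φ k)) (2 * jj k) _ _ hbk U).symm
    have hconj : ∀ U : GaugeConfig 4 (2 * sch.L (φ k) + 1) G,
        conj (fieldObs r (sch.L (φ k)) (sch.a (φ k)) ((((sch.c r.curvature (φ k) * sch.a (φ k) ^ 4) ^ n : ℝ) : ℂ) • F)
          (fun _ => sch.m r.curvature (φ k) / 6) U) =
        fieldObs r (sch.L (φ k)) (sch.a (φ k)) ((((sch.c r.curvature (φ k) * sch.a (φ k) ^ 4) ^ n : ℝ) : ℂ) • F)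
          (fun _ => sch.m r.curvature (φ k) / 6) U := fun U => conj_fieldObs r _ _ _ _ (hFkr k) U
    have hE2 : (∫ U, conj (fieldObs r (sch.L (φ k)) (sch.a (φ k))
            ((((sch.c r.curvature (φ k) * sch.a (φ k) ^ 4) ^ n : ℝ) : ℂ) • F) (fun _ => sch.m r.curvature (φ k) / 6)
            (GaugeConfig.timeReflect U)) *
          fieldObs r (sch.L (φ k)) (sch.a (φ k))
            ((((sch.c r.curvature (φ k) * sch.a (φ k) ^ 4) ^ n : ℝ) : ℂ) • translateMulti (vv k) F)
            (fun _ => sch.m r.curvature (φ k) / 6) U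
        ∂(wilsonMeasure r.ρ (sch.β (φ k)) : Measure (GaugeConfig 4 (2 * sch.L (φ k) + 1) G))).re =
        ∫ U, Y k (torusLift (2 * sch.L (φ k) + 1) (GaugeConfig.timeReflect U)) *
          Y k (configShift (-Pi.single 0 ((2 * jj k : ℕ) : ℤ)) (torusLift (2 * sch.L (φ k) + 1) U))
        ∂(wilsonMeasure r.ρ (sch.β (φ k)) : Measure (GaugeConfig 4 (2 * sch.L (φ k) + 1) G)) := by
      rw [← Complex.ofReal_re (∫ U, Y k (torusLift (2 * sch.L (φ k) + 1) (GaugeConfig.timeReflect U)) *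
          Y k (configShift (-Pi.single 0 ((2 * jj k : ℕ) : ℤ)) (torusLift (2 * sch.L (φ k) + 1) U))
        ∂(wilsonMeasure r.ρ (sch.β (φ k)) : Measure (GaugeConfig 4 (2 * sch.L (φ k) + 1) G))), ← integral_complex_ofReal]
      congr 1
      refine integral_congr_ae (ae_of_all _ fun U => ?_)
      dsimp only
      rw [hconj, Complex.ofReal_mul, e1, e2]
    have hE0 : (∫ U, conj (fieldObs r (sch.L (φ k)) (sch.a (φ k))
            ((((sch.c r.curvature (φ k) * sch.a (φ k) ^ 4) ^ n : ℝ) : ℂ) • F) (fun _ => sch.m r.curvature (φ k) / 6)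
            (GaugeConfig.timeReflect U)) *
          fieldObs r (sch.L (φ k)) (sch.a (φ k))
            ((((sch.c r.curvature (φ k) * sch.a (φ k) ^ 4) ^ n : ℝ) : ℂ) • F)
            (fun _ => sch.m r.curvature (φ k) / 6) U
          ∂(wilsonMeasure r.ρ (sch.β (φ k)) : Measure (GaugeConfig 4 (2 * sch.L (φ k) + 1) G))).re =
        ∫ U, Y k (torusLift (2 * sch.L (φ k) + 1) (GaugeConfig.timeReflect U)) * Y k (torusLift (2 * sch.L (φ k) + 1) U)
        ∂(wilsonMeasure r.ρ (sch.β (φ k)) : Measure (GaugeConfig 4 (2 * sch.L (φ k) + 1) G)) := by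
      rw [← Complex.ofReal_re (∫ U, Y k (torusLift (2 * sch.L (φ k) + 1) (GaugeConfig.timeReflect U)) *
          Y k (torusLift (2 * sch.L (φ k) + 1) U)
        ∂(wilsonMeasure r.ρ (sch.β (φ k)) : Measure (GaugeConfig 4 (2 * sch.L (φ k) + 1) G))), ← integral_complex_ofReal]
      congr 1
      refine integral_congr_ae (ae_of_all _ fun U => ?_)
      dsimp only
      rw [hconj, Complex.ofReal_mul, e1, e1]
    have hE1 : (∫ U, fieldObs r (sch.L (φ k)) (sch.a (φ k))
          ((((sch.c r.curvature (φ k) * sch.a (φ k) ^ 4) ^ n : ℝ) : ℂ) • F) (fun _ => sch.m r.curvature (φ k) / 6) U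
          ∂(wilsonMeasure r.ρ (sch.β (φ k)) : Measure (GaugeConfig 4 (2 * sch.L (φ k) + 1) G))).re =
        ∫ U, Y k (torusLift (2 * sch.L (φ k) + 1) U)
        ∂(wilsonMeasure r.ρ (sch.β (φ k)) : Measure (GaugeConfig 4 (2 * sch.L (φ k) + 1) G)) := by
      rw [← Complex.ofReal_re (∫ U, Y k (torusLift (2 * sch.L (φ k) + 1) U)
        ∂(wilsonMeasure r.ρ (sch.β (φ k)) : Measure (GaugeConfig 4 (2 * sch.L (φ k) + 1) G))), ← integral_complex_ofReal]
      congr 1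
      refine integral_congr_ae (ae_of_all _ fun U => ?_)
      dsimp only
      rw [e1]
    rw [hE2, hE0, hE1, hd2, hd0]
    -- the chord's error term in the form of `hTh`
    have herr : max 1 ((K₂ * (sch.a (φ k))⁻¹ ^ (Qr * n)) ^ 2 * Cmono n (⌊(ρ' : ℝ) / sch.a (φ k)⌋₊ + 2)) *
        Real.exp (-(Δ * sch.a (φ k) / 2 * (sch.L (φ k) : ℕ))) =
        max 1 ((K₂ * (sch.a (φ k))⁻¹ ^ (Qr * n)) ^ 2 * Cmono n (⌊(ρ' : ℝ) / sch.a (φ k)⌋₊ + 2)) *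
          Real.exp (-(Δ / 2 * (sch.a (φ k) * (sch.L (φ k) : ℝ)))) := by
      congr 2; ring
    rw [herr] at hchord
    exact hchord
  /- ### Limits of the two sides of the lattice inequality -/
  have hA2 := (Complex.continuous_re.tendsto _).comp hP2
  have hA0 := (Complex.continuous_re.tendsto _).comp hP0
  have hA1 := (Complex.continuous_re.tendsto _).comp hP1
  have hE : Tendsto (fun k => Real.exp (-(Δ * sch.a (φ k) / 2 * ((2 * jj k : ℕ) : ℝ)))) atTop
      (𝓝 (Real.exp (-(Δ / 2 * t)))) := by
    have h1 : Tendsto (fun k => -(Δ / 2 * (((2 * jj k : ℕ) : ℝ) * sch.a (φ k)))) atTop (𝓝 (-(Δ / 2 * t))) :=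
      (hcoef.const_mul (Δ / 2)).neg
    refine ((Real.continuous_exp.tendsto _).comp h1).congr fun k => ?_
    simp only [Function.comp_apply]
    ring_nf
  have hlim := le_of_tendsto_of_tendsto (hA2.sub (hA1.pow 2)) ((hE.mul (hA0.sub (hA1.pow 2))).add hTh) hineq
  simp only [add_zero] at hlim
  -- the connected OS forms of the limit family
  have hσ : planeSum T n F = (((planeSum T n F).re : ℝ) : ℂ) := (Complex.conj_eq_iff_re.1 hreal).symm
  have hcs : (conj (planeSum T n F) * planeSum T n F).re = (planeSum T n F).re ^ 2 := by
    rw [hreal]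
    conv_lhs => rw [hσ]
    rw [← Complex.ofReal_mul, Complex.ofReal_re]
    ring
  simp only [conn]
  rw [hherm, htrans, Complex.sub_re, Complex.sub_re, hcs]
  nlinarith [hlim, Real.exp_pos (-(Δ / 2 * t))]

end Main2

end Summit.QuantumFields.YangMills.Theorems.ContinuumFromLatticeGap

end
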